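import Literature.Probability.Percolation.QuadCrossingFourArmShadow
import Literature.Probability.Percolation.BlockResampling
import HarnessLib

/-!
# The steps of the hybrid chain in Schramm–Smirnov's discrete gluing (bond `ℤ²`)

Topic `Literature/Probability/Percolation`; proofs only.  In the proof of the discrete gluing
Theorem 1.1 (O. Schramm, S. Smirnov, *On the scaling limits of planar percolation*, Ann. Probab. 39
(2011), §2) the configuration near the cut `α` is resampled ball by ball (`ω_j` agrees with `ω'`
inside `B₁ ∪ ⋯ ∪ B_j` and with `ω` elsewhere; abstractly `ω_j = resample (U j) (ω, ω̃)`,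
`BlockResampling.lean`), and each step at which the crossing event of the quad `Q₀` changes is
charged to an arm event: "In order for `{ω_{j-1} ∈ ⊞_{Q₀}} ∩ {ω_j ∉ ⊞_{Q₀}}` to hold … in `ω_j` we
have the four arm event from `∂B_j` to `∂Q₀`"; the balls near the finitely many points `xᵢ` of
`α ∩ ∂Q₀` are treated in ONE final step, charged to "a crossing of `Q₀` which intersects [one] of
the disks `B(xᵢ, r)`", i.e. to an open arm around some `xᵢ`.  This file proves those deterministic
implications (the hypotheses `hstep` of the abstract gluing principle
`mul_measureReal_lt_blockCondProb_lt_le_sum`), for the raw crossing event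
`E = {ω | some crossing of Q lies inside openEdgeUnion δ ω}`:

* `diff_ball_subset_openEdgeUnion_resample` — if two blocks `U ⊆ U'` differ only by edges drawn
  inside `B(w, ρ)`, a set inside the open edges of `resample U x` has its part off `B(w, ρ)` inside
  the open edges of `resample U' x`;
* `resample_mem_fourArm_step` — **far ball inside the quad**: the step forces the translated later
  configuration into `fourArmTwoClusters (m'+1) (n'-1)` (`Quad.relabel_mem_fourArmTwoClusters_of_isCrossing`);
* `resample_mem_crossing_of_disjoint_ball` — **ball off the quad**: the step cannot happen;
* `resample_mem_annulusOpenCrossing_step` — **the final block near `α ∩ ∂Q₀ = {xᵢ}`**: the step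
  forces an open crossing of an annulus `A(xᵢ; r + δ, D - δ)` around one of the `xᵢ`
  (`mem_annulusOpenCrossing_of_isPreconnected'`), provided `2D ≤ dist(∂₀Q, ∂₂Q)`-type room
  (`D ≤ dist(x, y)/2` for all `x ∈ ∂₀Q`, `y ∈ ∂₂Q`) and the annuli avoid the other discs
  (`dist(xᵢ, xᵢ') ≥ D + r`).

## References

* O. Schramm, S. Smirnov, Ann. Probab. 39 (2011) 1768–1814, arXiv:1101.5820, §2 (proof of
  Thm. 1.1). [SchrammSmirnov2011]
-/

noncomputable section

open Set Metric
open Literature.Probability.LatticeModels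

namespace Literature.Probability.Percolation

namespace QuadCrossing

variable {D : Set ℂ} {δ : ℝ}

/-! ### Agreement of consecutive hybrids off the resampled ball -/

/-- **Consecutive hybrids agree off the ball.**  Let `U ⊆ U'` be edge sets differing only by lattice
edges drawn inside `B(w, ρ)`.  If `K` lies inside the drawn open edges of `resample U x`, then
`K ∖ B(w, ρ)` lies inside the drawn open edges of `resample U' x` (a point of `K` off the ball sits
on an open edge not drawn inside the ball, whose state is not resampled). [cite: SchrammSmirnov2011, §2 (proof of Thm. 1.1: ω_{j-1}, ω_j agree off B_j)] -/
theorem diff_ball_subset_openEdgeUnion_resample {U U' : Set (Sym2 (Site 2))} (hUU' : U ⊆ U')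
    {w : ℂ} {ρ : ℝ}
    (hIn : ∀ e ∈ U' \ U, ∃ a b : Site 2, e = s(a, b) ∧
      segment ℝ (meshPoint δ a) (meshPoint δ b) ⊆ ball w ρ)
    (x : BondConfig (Site 2) × BondConfig (Site 2)) {K : Set ℂ}
    (hK : K ⊆ openEdgeUnion δ (resample U x)) :
    K \ ball w ρ ⊆ openEdgeUnion δ (resample U' x) := by
  rintro z ⟨hzK, hzb⟩
  obtain ⟨a, b, hab, hω, hz⟩ := mem_openEdgeUnion_iff.1 (hK hzK)
  refine mem_openEdgeUnion_iff.2 ⟨a, b, hab, ?_, hz⟩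
  have hnot : s(a, b) ∉ U' \ U := by
    intro hmem
    obtain ⟨a', b', he, hseg⟩ := hIn _ hmem
    have hzs : z ∈ segment ℝ (meshPoint δ a') (meshPoint δ b') := by
      have hab' : s(a, b) = s(a', b') := he
      rcases Sym2.eq_iff.1 hab' with ⟨rfl, rfl⟩ | ⟨rfl, rfl⟩
      · exact hz
      · rw [segment_symm]; exact hz
    exact hzb (hseg hzs)
  have hiff : s(a, b) ∈ U ↔ s(a, b) ∈ U' :=
    ⟨fun h => hUU' h, fun h => by_contra fun h' => hnot ⟨h, h'⟩⟩
  exact (mem_resample_iff_mem_resample hiff x).1 hω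

/-! ### Far balls inside the quad: the four-arm step -/

namespace Quad

/-- **The four-arm step.**  With `E = {ω | some crossing of Q lies inside openEdgeUnion δ ω}`, blocks
`U ⊆ U'` differing only by edges drawn inside `B(w, ρ)`, and the geometric provisos of
`Quad.relabel_mem_fourArmTwoClusters_of_isCrossing` (the sides `∂₀Q, ∂₂Q` farther than `R ≥ ρ`
from `w`, `ρ + δ ≤ m'δ`, `√2 · n'δ ≤ R - δ`, the square `{‖· - δv‖_∞ ≤ (n'+2)δ} ⊆ [Q]`,
`v = nearestSite δ w`): if `resample U x ∈ E` and `resample U' x ∉ E` then `resample U' x`, when a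
lattice configuration, translated by `-v`, lies in `fourArmTwoClusters (m'+1) (n'-1)`.
[cite: SchrammSmirnov2011, §2 (proof of Thm. 1.1: "in ω_j we have the four arm event from ∂B_j to ∂Q₀")] -/
theorem resample_mem_fourArm_step (Q : Quad D) (hδ : 0 < δ) {U U' : Set (Sym2 (Site 2))}
    (hUU' : U ⊆ U') {w : ℂ} {ρ R : ℝ}
    (hIn : ∀ e ∈ U' \ U, ∃ a b : Site 2, e = s(a, b) ∧
      segment ℝ (meshPoint δ a) (meshPoint δ b) ⊆ ball w ρ)
    (hρR : ρ ≤ R) (hfar : ∀ z ∈ Q.side 0 ∪ Q.side 2, R < dist z w) {m' n' : ℕ} (hm' : 2 ≤ m')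
    (hmn : m' + 3 ≤ n') (hρm : ρ + δ ≤ m' * δ) (hnR : Real.sqrt 2 * (n' * δ) ≤ R - δ)
    (hT : {z : ℂ | max |(z - meshPoint δ (nearestSite δ w)).re|
      |(z - meshPoint δ (nearestSite δ w)).im| ≤ (n' + 2) * δ} ⊆ Q.carrier)
    (x : BondConfig (Site 2) × BondConfig (Site 2))
    (h₁ : ∃ K, Q.IsCrossing K ∧ K ⊆ openEdgeUnion δ (resample U x))
    (h₂ : ¬∃ K, Q.IsCrossing K ∧ K ⊆ openEdgeUnion δ (resample U' x))
    (hlat : resample U' x ⊆ (zdGraph 2).edgeSet) :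
    BondConfig.relabel (sym2Equiv (zdShiftIso (-nearestSite δ w)).toEquiv) (resample U' x) ∈
      fourArmTwoClusters (m' + 1) (n' - 1) := by
  obtain ⟨K, hK, hKO⟩ := h₁
  exact Q.relabel_mem_fourArmTwoClusters_of_isCrossing hδ hlat hK
    (diff_ball_subset_openEdgeUnion_resample hUU' hIn x hKO) (fun K' hK' hK'O => h₂ ⟨K', hK', hK'O⟩)
    hρR hfar hm' hmn hρm hnR hT

/-! ### Balls off the quad: no step -/

/-- **Balls off the quad cannot change the crossing event**: if `B(w, ρ)` misses `[Q]` and `U ⊆ U'`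
differ only by edges drawn inside it, a crossing inside the open edges of `resample U x` is one
inside the open edges of `resample U' x`. [cite: SchrammSmirnov2011, §2 (proof of Thm. 1.1)] -/
theorem resample_mem_crossing_of_disjoint_ball (Q : Quad D) {U U' : Set (Sym2 (Site 2))}
    (hUU' : U ⊆ U') {w : ℂ} {ρ : ℝ}
    (hIn : ∀ e ∈ U' \ U, ∃ a b : Site 2, e = s(a, b) ∧
      segment ℝ (meshPoint δ a) (meshPoint δ b) ⊆ ball w ρ)
    (hdisj : Disjoint (ball w ρ) Q.carrier) (x : BondConfig (Site 2) × BondConfig (Site 2))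
    (h₁ : ∃ K, Q.IsCrossing K ∧ K ⊆ openEdgeUnion δ (resample U x)) :
    ∃ K, Q.IsCrossing K ∧ K ⊆ openEdgeUnion δ (resample U' x) := by
  obtain ⟨K, hK, hKO⟩ := h₁
  refine ⟨K, hK, fun z hz => diff_ball_subset_openEdgeUnion_resample hUU' hIn x hKO ⟨hz, ?_⟩⟩
  exact fun hb => Set.disjoint_left.1 hdisj hb (hK.2.2.1 hz)

/-! ### The final block near the boundary points: the one-arm step -/

/-- **The one-arm step for the final block.**  Let `U ⊆ U'` differ only by edges drawn inside the
discs `B(xᵢ, r)`, `i ∈ ι` (finite, in the source the points of `α ∩ ∂Q₀`), let `r ≤ D'` with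
`dist z y ≥ 2D'` for all `z ∈ ∂₀Q`, `y ∈ ∂₂Q` (e.g. `2D' ≤ dist(∂₀Q, ∂₂Q)`) and
`dist xᵢ xᵢ' ≥ D' + r` for `i ≠ i'`.  If `resample U x ∈ E` but `resample U' x ∉ E`, then for some
`i` the later configuration has an open crossing of the annulus `A(xᵢ; r + δ, D' - δ)`: the old
crossing must use a resampled edge, hence meets some `B(xᵢ, r)`; it also reaches distance `≥ D'`
from `xᵢ` (one of its endpoints on `∂₀Q`, `∂₂Q` is that far); its sub-continuum in the closed
annulus `r ≤ dist(·, xᵢ) ≤ D'` avoids all the discs, so it lies in the later open edges.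
[cite: SchrammSmirnov2011, §2 (proof of Thm. 1.1: "the probability … that there is a crossing of Q₀ which intersects any of the disks B(xᵢ, r)")] -/
theorem resample_mem_annulusOpenCrossing_step (Q : Quad D) (hδ : 0 < δ) {ι : Type*}
    (xs : ι → ℂ) {U U' : Set (Sym2 (Site 2))} (hUU' : U ⊆ U') {r D' : ℝ} (hrD : r ≤ D')
    (hIn : ∀ e ∈ U' \ U, ∃ i, ∃ a b : Site 2, e = s(a, b) ∧
      segment ℝ (meshPoint δ a) (meshPoint δ b) ⊆ ball (xs i) r)
    (hsides : ∀ z ∈ Q.side 0, ∀ y ∈ Q.side 2, 2 * D' ≤ dist z y)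
    (hsep : ∀ i i', i ≠ i' → D' + r ≤ dist (xs i) (xs i'))
    (x : BondConfig (Site 2) × BondConfig (Site 2))
    (h₁ : ∃ K, Q.IsCrossing K ∧ K ⊆ openEdgeUnion δ (resample U x))
    (h₂ : ¬∃ K, Q.IsCrossing K ∧ K ⊆ openEdgeUnion δ (resample U' x)) :
    ∃ i, resample U' x ∈ annulusOpenCrossing (xs i) δ (r + δ) (D' - δ) := by
  obtain ⟨K, hK, hKO⟩ := h₁
  obtain ⟨hKc, hKconn, hKQ, ⟨x₀, hx₀K, hx₀⟩, ⟨x₂, hx₂K, hx₂⟩⟩ := hK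
  -- an open edge of the old configuration is open in the new one unless drawn inside a disc
  have hedge : ∀ a b : Site 2, (zdGraph 2).Adj a b → s(a, b) ∈ resample U x →
      s(a, b) ∉ resample U' x → ∃ i, segment ℝ (meshPoint δ a) (meshPoint δ b) ⊆ ball (xs i) r := by
    intro a b _ hω hω'
    by_contra hcon
    push Not at hcon
    have hnot : s(a, b) ∉ U' \ U := by
      intro hmem
      obtain ⟨i, a', b', he, hseg⟩ := hIn _ hmem
      refine hcon i ?_
      have hab' : s(a, b) = s(a', b') := he
      rcases Sym2.eq_iff.1 hab' with ⟨rfl, rfl⟩ | ⟨rfl, rfl⟩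
      · exact hseg
      · rw [segment_symm]; exact hseg
    have hiff : s(a, b) ∈ U ↔ s(a, b) ∈ U' :=
      ⟨fun h => hUU' h, fun h => by_contra fun h' => hnot ⟨h, h'⟩⟩
    exact hω' ((mem_resample_iff_mem_resample hiff x).1 hω)
  -- the old crossing is not inside the new open edges: it meets some disc
  have hmeet : ∃ i, ∃ z ∈ K, dist z (xs i) ≤ r := by
    by_contra hcon
    push Not at hcon
    refine h₂ ⟨K, ⟨hKc, hKconn, hKQ, ⟨x₀, hx₀K, hx₀⟩, ⟨x₂, hx₂K, hx₂⟩⟩, fun z hzK => ?_⟩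
    obtain ⟨a, b, hab, hω, hz⟩ := mem_openEdgeUnion_iff.1 (hKO hzK)
    refine mem_openEdgeUnion_iff.2 ⟨a, b, hab, ?_, hz⟩
    by_contra hω'
    obtain ⟨i, hseg⟩ := hedge a b hab hω hω'
    exact not_le.2 (mem_ball.1 (hseg hz)) (hcon i z hzK).le
  obtain ⟨i, z, hzK, hzr⟩ := hmeet
  -- one endpoint is far from `xs i`
  have hfarpt : ∃ y ∈ K, D' ≤ dist y (xs i) := by
    by_contra hcon
    push Not at hcon
    have h0 := hcon x₀ hx₀K
    have h2 := hcon x₂ hx₂K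
    have h3 := hsides x₀ hx₀ x₂ hx₂
    have h4 := dist_triangle x₀ (xs i) x₂
    rw [dist_comm (xs i) x₂] at h4
    linarith
  obtain ⟨K', hK'K, hK'c, hK'p, hK'ann, hK'r, hK'D⟩ :=
    exists_subcontinuum_annulus (xs i) hrD hKc hKconn.isPreconnected ⟨z, hzK, hzr⟩ hfarpt
  -- the sub-continuum in the annulus lies inside the new open edges
  have hK'O : K' ⊆ openEdgeUnion δ (resample U' x) := by
    intro y hy
    obtain ⟨a, b, hab, hω, hys⟩ := mem_openEdgeUnion_iff.1 (hKO (hK'K hy))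
    refine mem_openEdgeUnion_iff.2 ⟨a, b, hab, ?_, hys⟩
    by_contra hω'
    obtain ⟨i', hseg⟩ := hedge a b hab hω hω'
    have hyi' : dist y (xs i') < r := mem_ball.1 (hseg hys)
    obtain ⟨hyr, hyD⟩ := hK'ann y hy
    by_cases hii' : i = i'
    · subst hii'; exact not_lt.2 hyr hyi'
    · have h5 := hsep i i' hii'
      have h6 := dist_triangle (xs i) y (xs i')
      rw [dist_comm (xs i) y] at h6
      linarith
  refine ⟨i, mem_annulusOpenCrossing_of_isPreconnected' hδ (xs i) hrD hK'c hK'p hK'O ?_ ?_⟩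
  · obtain ⟨y, hy, hyr⟩ := hK'r; exact ⟨y, hy, hyr.le⟩
  · obtain ⟨y, hy, hyD⟩ := hK'D; exact ⟨y, hy, hyD.ge⟩

end Quad

end QuadCrossing

end Literature.Probability.Percolation

end
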